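import Literature.Geometry.Kaehler.ComplexTorusAnalyticIteratedIntersectionProperComponents
import HarnessLib

/-!
# Equality in Bézout's theorem: if an iterated intersection `Y ∩ ⋂_j (D_j − τ_j)` has as many proper
# components as the intersection number `(L^{r+1} · Y · D₀ ⋯ D_{k−1})` allows, then every proper component
# has multiplicity one and `L`-degree one, and there is no excess contribution

Layer `Literature/Geometry/Kaehler`; lane `lit-hodgefound`, seat p07, programme «INTERSECTION NUMBERS ARE
POINT COUNTS», file 20. Let `X = E/Λ` be a compact complex torus polarised by a Riemann form `η`
(`c₁(L) = ofRealForm(−η)`), `Y ⊆ X` closed analytic of pure dimension `d = r + 1 + k`, `D₀, …, D_{k−1}` closed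
analytic hypersurfaces, `τ ∈ X^k` ARBITRARY, `Z(τ) = Y ∩ ⋂_j (D_j − τ_j)`, and
`m = (L^{r+1} · Y · D₀ ⋯ D_{k−1}) = Re ⟨c₁(L)^{∧(r+1)}, sign(e)^k · [Y] ∧ [D₀] ∧ ⋯ ∧ [D_{k−1}]⟩ ∈ ℕ`. By file 19
the effective Fulton `(r+1)`-cycle `R = Σ_W m_W W` representing the intersection class contains every proper
component `C` of `Z(τ)` (irreducible component of the expected dimension `r + 1`) with `m_C ≥ 1`, whence
Fulton's form of Bézout's theorem `Σ_W m_W · deg_L W = m` [Fulton1998, §8.4 (1)] gives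
`#{proper components} ≤ m`. This file is the EQUALITY CASE: if `#{proper components} ≥ m` (hence `= m`), then

* the components of `R` are exactly the proper components of `Z(τ)` (no excess component contributes),
* every proper component has multiplicity `m_C = 1` ("`i(Z, V₁ ⋯ V_r) = 1`", generic transversality along
  `C` in the algebraic setting, [Fulton1998, Prop. 8.2 (c)]) and `L`-degree `(L^{r+1} · C) = 1`,
* `sign(e)^k · [Y] ∧ [D₀] ∧ ⋯ ∧ [D_{k−1}] = Σ_{C proper} [C]`, `|R| = ⋃_{C proper} C`, and the intersection
  number is exactly `#{proper components}`;

and for a PROPER `Z(τ)` (every component proper) with `#{components} ≥ m`: MULTIPLICITY ONE,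
`sign(e)^k · [Y] ∧ [D₀] ∧ ⋯ ∧ [D_{k−1}] = [Z(τ)]`, all components of `L`-degree one. (Expected dimension `0`:
`#Z(τ) = N ⟺ class = [Z(τ)]` is file 14.)

> [Fulton1998, §8.2 Prop. 8.2 (a), (c) (p. 137–138); §8.4 display (1) (p. 145) and Example 8.4.6
> (p. 148); §12.2 Cor. 12.2 (a) and Example 12.2.1 (a) (p. 212–213)];
> [deJong1993AmpleLineBundles, Ch. VII §4 Remarks 4.3 (a), (c) and Thm. 4.3.1].

Contents (theorems only; no definitions, no named facts):

* §1 **`IsRiemannForm.exists_effectiveCycle_of_re_poincarePairing_le_card_properComponents`** — THE THEOREM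
  (amid excess components), with the corollaries `…smul_wedge_wedgeFamily_eq_sum_setCycleClass_of_…`
  (`class = Σ_{C proper} [C]`), `…poincarePairing_wedgePow_analyticCycleClass_eq_one_of_…` (`deg_L C = 1`),
  `…poincarePairing_eq_card_of_…` (the intersection number is `#{proper components}`);
* §2 proper `Z(τ)`: **`IsRiemannForm.smul_wedge_wedgeFamily_eq_setCycleClass_of_re_poincarePairing_le_card`**
  (multiplicity one) and its `Set.ncard` form.

## References

* [Fulton1998] W. Fulton, *Intersection Theory*, 2nd ed., Springer 1998, §8.2 Prop. 8.2, §8.4 (1) and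
  Example 8.4.6, §12.2 Cor. 12.2 (a) and Example 12.2.1 (a).
* [deJong1993AmpleLineBundles] J. de Jong (ed.), *Ample line bundles and intersection theory*, in:
  Diophantine Approximation and Abelian Varieties, LNM 1566, Springer 1993, Ch. VII §4 Remarks 4.3 and
  Thm. 4.3.1.
* [Chirka1989] E. M. Chirka, *Complex Analytic Sets*, Kluwer 1989, §11.5 Def. (p. 130), §16.1 (p. 206).
* [Lange2023AbelianVarietiesComplex] H. Lange, *Abelian Varieties over the Complex Numbers*, Springer 2023,
  §4.6.2 p. 235.
-/

noncomputable section

open scoped Manifold Topology Pointwise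
open MeasureTheory Set Function Filter Module
open Literature.LinearAlgebra.Alternating

namespace Literature.Geometry.Kaehler
namespace ComplexTorus

universe u

variable {ι : Type*} [Fintype ι] [DecidableEq ι] {E : Type u} [NormedAddCommGroup E] [InnerProductSpace ℂ E]
  [FiniteDimensional ℂ E] [MeasurableSpace E] [BorelSpace E] (Φ : (ι → ℝ) ≃L[ℝ] E) {n : ℕ} (e : Fin n ≃ ι)

/-! ### §1 Equality in Bézout amid excess components -/

/-- **EQUALITY IN BÉZOUT'S THEOREM (amid excess components).** Let `η` be a Riemann form
(`c₁(L) = ofRealForm(−η)`), `Y` closed analytic of pure dimension `r + 1 + k`, `D₀, …, D_{k−1}` closed analytic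
hypersurfaces, `τ ∈ X^k` arbitrary, and let the finite set `S` list the proper components of
`Z(τ) = Y ∩ ⋂_j (D_j − τ_j)` (irreducible components of pure dimension `r + 1`). If
`(L^{r+1} · Y · D₀ ⋯ D_{k−1}) ≤ #S` then there is an effective `(r+1)`-cycle `R` on `Z(τ)` representing
`sign(e)^k · [Y]_e ∧ [D₀]_e ∧ ⋯ ∧ [D_{k−1}]_e` whose components are EXACTLY the members of `S`, each with
multiplicity `1` and `L`-degree `⟨c₁(L)^{∧(r+1)}, [C]⟩ = 1`; consequently `|R| = ⋃_{C ∈ S} C`, the class is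
`Σ_{C ∈ S} [C]`, and the intersection number equals `#S`. Proof: `#S ≤ #{components of R} ≤ Σ_W m_W deg_L W
= (L^{r+1} · Y · D₀ ⋯) ≤ #S` (file 19: `S ⊆ components(R)`; `m_W ≥ 1`, `deg_L W ≥ 1`), so all inequalities are
equalities. [cite: Fulton1998, §8.2 Prop. 8.2 (a), §8.4 (1) and Example 8.4.6, §12.2 Cor. 12.2 (a)]
[cite: deJong1993AmpleLineBundles, Ch. VII §4 Remarks 4.3 (a), (c) and Thm. 4.3.1] -/
theorem IsRiemannForm.exists_effectiveCycle_of_re_poincarePairing_le_card_properComponents {q : ℕ}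
    (hq : 2 * q + 2 * 1 = n) (k : ℕ) {d p p' r : ℕ} (hk : 2 * d + 2 * p = n) (hp' : p + k = p')
    (hr : r + 1 + k = d) {Y : Set (ComplexTorus Φ)} (hY : HasPureDim 𝓘(ℂ, E) Y d)
    {D : Fin k → Set (ComplexTorus Φ)} (hD : ∀ j, HasPureDim 𝓘(ℂ, E) (D j) q) (τ : Fin k → ComplexTorus Φ)
    (S : Finset (Set (ComplexTorus Φ)))
    (hS : ∀ C, C ∈ S ↔ IsIrreducibleComponent 𝓘(ℂ, E) (Y ∩ ⋂ j, (fun x ↦ x + τ j) ⁻¹' D j) C ∧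
      HasPureDim 𝓘(ℂ, E) C (r + 1))
    {η : E [⋀^Fin 2]→L[ℝ] ℝ} (hη : IsRiemannForm Φ η)
    (hle : (poincarePairing Φ e (by omega : 2 * (r + 1) + 2 * p' = n) (wedgePow (ofRealForm (-η)) (r + 1))
        ((orientationSign Φ e : ℂ) ^ k •
          ((analyticCycleClass Φ e hk hY).wedge
              (wedgeFamily k fun j ↦ analyticCycleClass Φ e hq (hD j))).domDomCongr
            (finCongr (by omega : 2 * p + 2 * k = 2 * p')))).re ≤ S.card) :
    ∃ R : HolomorphicChain 𝓘(ℂ, E) (ComplexTorus Φ) (r + 1), (∀ W, 0 ≤ R.mult W) ∧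
      R.support ⊆ Y ∩ ⋂ j, (fun x ↦ x + τ j) ⁻¹' D j ∧
      (∀ W, R.mult W ≠ 0 ↔ W ∈ S) ∧ (∀ C ∈ S, R.mult C = 1) ∧
      (∀ C ∈ S, poincarePairing Φ e (by omega : 2 * (r + 1) + 2 * p' = n) (wedgePow (ofRealForm (-η)) (r + 1))
        (setCycleClass Φ e (by omega : 2 * (r + 1) + 2 * p' = n) C) = 1) ∧
      R.support = ⋃ C ∈ S, C ∧
      (orientationSign Φ e : ℂ) ^ k •
          ((analyticCycleClass Φ e hk hY).wedge
              (wedgeFamily k fun j ↦ analyticCycleClass Φ e hq (hD j))).domDomCongr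
            (finCongr (by omega : 2 * p + 2 * k = 2 * p')) =
        chainCycleClass Φ e (by omega : 2 * (r + 1) + 2 * p' = n) R ∧
      (orientationSign Φ e : ℂ) ^ k •
          ((analyticCycleClass Φ e hk hY).wedge
              (wedgeFamily k fun j ↦ analyticCycleClass Φ e hq (hD j))).domDomCongr
            (finCongr (by omega : 2 * p + 2 * k = 2 * p')) =
        ∑ C ∈ S, setCycleClass Φ e (by omega : 2 * (r + 1) + 2 * p' = n) C ∧
      poincarePairing Φ e (by omega : 2 * (r + 1) + 2 * p' = n) (wedgePow (ofRealForm (-η)) (r + 1))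
        ((orientationSign Φ e : ℂ) ^ k •
          ((analyticCycleClass Φ e hk hY).wedge
              (wedgeFamily k fun j ↦ analyticCycleClass Φ e hq (hD j))).domDomCongr
            (finCongr (by omega : 2 * p + 2 * k = 2 * p'))) = S.card := by
  classical
  have h2 : 2 * (r + 1) + 2 * p' = n := by omega
  obtain ⟨R, hR0, hRs, -, hprop, hRcl⟩ :=
    exists_effectiveCycle_smul_wedge_wedgeFamily_eq_chainCycleClass_forall_one_le_mult Φ e hq k hk hp' hr hY hD τ
  set c := (orientationSign Φ e : ℂ) ^ k •
      ((analyticCycleClass Φ e hk hY).wedge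
          (wedgeFamily k fun j ↦ analyticCycleClass Φ e hq (hD j))).domDomCongr
        (finCongr (by omega : 2 * p + 2 * k = 2 * p')) with hc
  set θ : E [⋀^Fin (2 * (r + 1))]→L[ℝ] ℂ := wedgePow (ofRealForm (-η)) (r + 1) with hθ
  set F := R.finite_components_of_compactSpace.toFinset with hF
  have hFmem : ∀ W, W ∈ F ↔ R.mult W ≠ 0 := fun W ↦ by
    rw [hF, Set.Finite.mem_toFinset, HolomorphicChain.mem_components_iff]
  -- the proper components are components of `R`
  have hSF : S ⊆ F := fun C hC ↦ by
    rw [hFmem]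
    have h1 := (hprop C ((hS C).1 hC).1 ((hS C).1 hC).2).2
    omega
  -- every component has multiplicity `≥ 1` and `L`-degree `≥ 1`
  have hmult : ∀ W ∈ F, (1 : ℝ) ≤ ((R.mult W : ℤ) : ℝ) := fun W hW ↦ by
    have h0 := hR0 W
    have hW0 := (hFmem W).1 hW
    exact_mod_cast (show (1 : ℤ) ≤ R.mult W by omega)
  have hdeg : ∀ W ∈ F, 1 ≤ (poincarePairing Φ e h2 θ (setCycleClass Φ e h2 W)).re := fun W hW ↦ by
    rw [poincarePairing_setCycleClass Φ e h2 (R.hasPureDim_of_mult_ne_zero ((hFmem W).1 hW))]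
    exact hη.one_le_re_analyticCyclePeriod_wedgePow Φ _
  -- Bézout: `(L^{r+1} · class) = Σ_W m_W deg_L W`
  have hsum : (poincarePairing Φ e h2 θ c).re =
      ∑ W ∈ F, ((R.mult W : ℤ) : ℝ) * (poincarePairing Φ e h2 θ (setCycleClass Φ e h2 W)).re := by
    rw [hRcl, poincarePairing_chainCycleClass, Complex.re_sum]
    refine Finset.sum_congr rfl fun W _ ↦ ?_
    rw [← Complex.ofReal_intCast, Complex.re_ofReal_mul]
  have hterm : ∀ W ∈ F, (1 : ℝ) ≤ ((R.mult W : ℤ) : ℝ) * (poincarePairing Φ e h2 θ (setCycleClass Φ e h2 W)).re :=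
    fun W hW ↦ by nlinarith [hmult W hW, hdeg W hW]
  have hFcard : (F.card : ℝ) ≤
      ∑ W ∈ F, ((R.mult W : ℤ) : ℝ) * (poincarePairing Φ e h2 θ (setCycleClass Φ e h2 W)).re := by
    rw [Finset.card_eq_sum_ones, Nat.cast_sum, Nat.cast_one]
    exact Finset.sum_le_sum hterm
  -- hence `F = S`
  have hFS : F = S := by
    symm
    refine Finset.eq_of_subset_of_card_le hSF ?_
    have h : (F.card : ℝ) ≤ S.card := hFcard.trans (hsum ▸ hle)
    exact_mod_cast h
  -- and every term `m_W deg_L W` equals `1`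
  have hterm1 : ∀ W ∈ F, ((R.mult W : ℤ) : ℝ) * (poincarePairing Φ e h2 θ (setCycleClass Φ e h2 W)).re = 1 := by
    have hsumle : ∑ W ∈ F, ((R.mult W : ℤ) : ℝ) * (poincarePairing Φ e h2 θ (setCycleClass Φ e h2 W)).re ≤
        ∑ W ∈ F, (1 : ℝ) := by
      rw [Finset.sum_const, nsmul_eq_mul, mul_one, ← hsum, hFS]
      exact hle
    have heq : ∑ W ∈ F, (1 : ℝ) =
        ∑ W ∈ F, ((R.mult W : ℤ) : ℝ) * (poincarePairing Φ e h2 θ (setCycleClass Φ e h2 W)).re :=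
      le_antisymm (Finset.sum_le_sum hterm) hsumle
    intro W hW
    exact ((Finset.sum_eq_sum_iff_of_le hterm).1 heq W hW).symm
  have hmult1 : ∀ W ∈ F, R.mult W = 1 := fun W hW ↦ by
    have hm := hmult W hW
    have hd := hdeg W hW
    have h1 := hterm1 W hW
    have hm1 : ((R.mult W : ℤ) : ℝ) = 1 := by
      nlinarith [mul_nonneg (sub_nonneg.2 hm) (sub_nonneg.2 hd)]
    exact_mod_cast hm1
  have hdeg1 : ∀ W ∈ F, poincarePairing Φ e h2 θ (setCycleClass Φ e h2 W) = 1 := fun W hW ↦ by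
    have hm := hmult W hW
    have hd := hdeg W hW
    have h1 := hterm1 W hW
    have hd1 : (poincarePairing Φ e h2 θ (setCycleClass Φ e h2 W)).re = 1 := by
      nlinarith [mul_nonneg (sub_nonneg.2 hm) (sub_nonneg.2 hd)]
    -- the `L`-degree is a natural number
    have hWd := R.hasPureDim_of_mult_ne_zero ((hFmem W).1 hW)
    obtain ⟨mW, -, hmW⟩ := IsRiemannForm.exists_pos_analyticCyclePeriod_wedgeFamily_eq Φ hWd fun _ : Fin (r + 1) ↦ hη
    rw [poincarePairing_setCycleClass Φ e h2 hWd] at hd1 ⊢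
    rw [hθ]
    change analyticCyclePeriod Φ hWd (wedgeFamily (r + 1) fun _ ↦ ofRealForm (-η)) = 1
    change (analyticCyclePeriod Φ hWd (wedgeFamily (r + 1) fun _ ↦ ofRealForm (-η))).re = 1 at hd1
    rw [hmW, Complex.natCast_re] at hd1
    rw [hmW]
    exact_mod_cast hd1
  have hcl : c = ∑ C ∈ S, setCycleClass Φ e h2 C := by
    rw [hRcl, chainCycleClass, ← hF, hFS]
    refine Finset.sum_congr rfl fun C hC ↦ ?_
    rw [hmult1 C (hFS ▸ hC), one_zsmul]
  refine ⟨R, hR0, hRs, fun W ↦ by rw [← hFmem, hFS], fun C hC ↦ hmult1 C (hFS ▸ hC),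
    fun C hC ↦ hdeg1 C (hFS ▸ hC), ?_, hRcl, hcl, ?_⟩
  · rw [HolomorphicChain.support_eq_biUnion_toFinset, ← hF, hFS]
  · rw [hcl, map_sum, Finset.sum_congr rfl fun C hC ↦ hdeg1 C (hFS ▸ hC), Finset.sum_const, nsmul_eq_mul,
      mul_one]

/-- **Equality in Bézout ⇒ `sign(e)^k · [Y] ∧ [D₀] ∧ ⋯ ∧ [D_{k−1}] = Σ_{C proper} [C]`**: if the proper components
of an arbitrary `Z(τ)` are at least `(L^{r+1} · Y · D₀ ⋯ D_{k−1})` in number, the intersection class is the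
sum of their classes (multiplicity one, no excess contribution). [cite: Fulton1998, §8.4 (1) and Example 8.4.6, §12.2 Cor. 12.2 (a)]
[cite: deJong1993AmpleLineBundles, Ch. VII §4 Thm. 4.3.1] -/
theorem IsRiemannForm.smul_wedge_wedgeFamily_eq_sum_setCycleClass_of_re_poincarePairing_le_card {q : ℕ}
    (hq : 2 * q + 2 * 1 = n) (k : ℕ) {d p p' r : ℕ} (hk : 2 * d + 2 * p = n) (hp' : p + k = p')
    (hr : r + 1 + k = d) {Y : Set (ComplexTorus Φ)} (hY : HasPureDim 𝓘(ℂ, E) Y d)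
    {D : Fin k → Set (ComplexTorus Φ)} (hD : ∀ j, HasPureDim 𝓘(ℂ, E) (D j) q) (τ : Fin k → ComplexTorus Φ)
    (S : Finset (Set (ComplexTorus Φ)))
    (hS : ∀ C, C ∈ S ↔ IsIrreducibleComponent 𝓘(ℂ, E) (Y ∩ ⋂ j, (fun x ↦ x + τ j) ⁻¹' D j) C ∧
      HasPureDim 𝓘(ℂ, E) C (r + 1))
    {η : E [⋀^Fin 2]→L[ℝ] ℝ} (hη : IsRiemannForm Φ η)
    (hle : (poincarePairing Φ e (by omega : 2 * (r + 1) + 2 * p' = n) (wedgePow (ofRealForm (-η)) (r + 1))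
        ((orientationSign Φ e : ℂ) ^ k •
          ((analyticCycleClass Φ e hk hY).wedge
              (wedgeFamily k fun j ↦ analyticCycleClass Φ e hq (hD j))).domDomCongr
            (finCongr (by omega : 2 * p + 2 * k = 2 * p')))).re ≤ S.card) :
    (orientationSign Φ e : ℂ) ^ k •
        ((analyticCycleClass Φ e hk hY).wedge
            (wedgeFamily k fun j ↦ analyticCycleClass Φ e hq (hD j))).domDomCongr
          (finCongr (by omega : 2 * p + 2 * k = 2 * p')) =
      ∑ C ∈ S, setCycleClass Φ e (by omega : 2 * (r + 1) + 2 * p' = n) C := by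
  obtain ⟨-, -, -, -, -, -, -, -, hcl, -⟩ :=
    hη.exists_effectiveCycle_of_re_poincarePairing_le_card_properComponents Φ e hq k hk hp' hr hY hD τ S hS hle
  exact hcl

/-- **Equality in Bézout ⇒ every proper component has `L`-degree one**: `⟨c₁(L)^{∧(r+1)}, [C]⟩ = 1`.
[cite: Fulton1998, §8.4 (1) and Example 8.4.6] [cite: deJong1993AmpleLineBundles, Ch. VII §4 Remarks 4.3 (a) and Thm. 4.3.1] -/
theorem IsRiemannForm.poincarePairing_wedgePow_analyticCycleClass_eq_one_of_re_poincarePairing_le_card {q : ℕ}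
    (hq : 2 * q + 2 * 1 = n) (k : ℕ) {d p p' r : ℕ} (hk : 2 * d + 2 * p = n) (hp' : p + k = p')
    (hr : r + 1 + k = d) {Y : Set (ComplexTorus Φ)} (hY : HasPureDim 𝓘(ℂ, E) Y d)
    {D : Fin k → Set (ComplexTorus Φ)} (hD : ∀ j, HasPureDim 𝓘(ℂ, E) (D j) q) (τ : Fin k → ComplexTorus Φ)
    (S : Finset (Set (ComplexTorus Φ)))
    (hS : ∀ C, C ∈ S ↔ IsIrreducibleComponent 𝓘(ℂ, E) (Y ∩ ⋂ j, (fun x ↦ x + τ j) ⁻¹' D j) C ∧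
      HasPureDim 𝓘(ℂ, E) C (r + 1))
    {η : E [⋀^Fin 2]→L[ℝ] ℝ} (hη : IsRiemannForm Φ η)
    (hle : (poincarePairing Φ e (by omega : 2 * (r + 1) + 2 * p' = n) (wedgePow (ofRealForm (-η)) (r + 1))
        ((orientationSign Φ e : ℂ) ^ k •
          ((analyticCycleClass Φ e hk hY).wedge
              (wedgeFamily k fun j ↦ analyticCycleClass Φ e hq (hD j))).domDomCongr
            (finCongr (by omega : 2 * p + 2 * k = 2 * p')))).re ≤ S.card)
    {C : Set (ComplexTorus Φ)} (hC : C ∈ S) :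
    poincarePairing Φ e (by omega : 2 * (r + 1) + 2 * p' = n) (wedgePow (ofRealForm (-η)) (r + 1))
      (analyticCycleClass Φ e (by omega : 2 * (r + 1) + 2 * p' = n) ((hS C).1 hC).2) = 1 := by
  obtain ⟨-, -, -, -, -, hdeg, -⟩ :=
    hη.exists_effectiveCycle_of_re_poincarePairing_le_card_properComponents Φ e hq k hk hp' hr hY hD τ S hS hle
  rw [← setCycleClass_of_hasPureDim Φ e _ ((hS C).1 hC).2]
  exact hdeg C hC

/-- **Equality in Bézout ⇒ the intersection number IS the number of proper components**:
`(L^{r+1} · Y · D₀ ⋯ D_{k−1}) = #S` as soon as `(L^{r+1} · Y · D₀ ⋯ D_{k−1}) ≤ #S`. [cite: Fulton1998, §8.4 (1) and Example 8.4.6]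
[cite: deJong1993AmpleLineBundles, Ch. VII §4 Thm. 4.3.1] -/
theorem IsRiemannForm.poincarePairing_eq_card_of_re_poincarePairing_le_card {q : ℕ}
    (hq : 2 * q + 2 * 1 = n) (k : ℕ) {d p p' r : ℕ} (hk : 2 * d + 2 * p = n) (hp' : p + k = p')
    (hr : r + 1 + k = d) {Y : Set (ComplexTorus Φ)} (hY : HasPureDim 𝓘(ℂ, E) Y d)
    {D : Fin k → Set (ComplexTorus Φ)} (hD : ∀ j, HasPureDim 𝓘(ℂ, E) (D j) q) (τ : Fin k → ComplexTorus Φ)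
    (S : Finset (Set (ComplexTorus Φ)))
    (hS : ∀ C, C ∈ S ↔ IsIrreducibleComponent 𝓘(ℂ, E) (Y ∩ ⋂ j, (fun x ↦ x + τ j) ⁻¹' D j) C ∧
      HasPureDim 𝓘(ℂ, E) C (r + 1))
    {η : E [⋀^Fin 2]→L[ℝ] ℝ} (hη : IsRiemannForm Φ η)
    (hle : (poincarePairing Φ e (by omega : 2 * (r + 1) + 2 * p' = n) (wedgePow (ofRealForm (-η)) (r + 1))
        ((orientationSign Φ e : ℂ) ^ k •
          ((analyticCycleClass Φ e hk hY).wedge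
              (wedgeFamily k fun j ↦ analyticCycleClass Φ e hq (hD j))).domDomCongr
            (finCongr (by omega : 2 * p + 2 * k = 2 * p')))).re ≤ S.card) :
    poincarePairing Φ e (by omega : 2 * (r + 1) + 2 * p' = n) (wedgePow (ofRealForm (-η)) (r + 1))
        ((orientationSign Φ e : ℂ) ^ k •
          ((analyticCycleClass Φ e hk hY).wedge
              (wedgeFamily k fun j ↦ analyticCycleClass Φ e hq (hD j))).domDomCongr
            (finCongr (by omega : 2 * p + 2 * k = 2 * p'))) = S.card := by
  obtain ⟨-, -, -, -, -, -, -, -, -, hcard⟩ :=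
    hη.exists_effectiveCycle_of_re_poincarePairing_le_card_properComponents Φ e hq k hk hp' hr hY hD τ S hS hle
  exact hcard

/-! ### §2 Proper intersections: equality in Bézout is multiplicity one with components of degree one -/

omit [DecidableEq ι] [MeasurableSpace E] [BorelSpace E] in
/-- The components of a proper `Z(τ)` (empty or of pure dimension `r + 1`) are exactly its proper components.
[cite: Chirka1989, §5.4 Thm., p. 57] -/
private theorem isIrreducibleComponent_iff_and_hasPureDim_of_proper₂₀ {k r : ℕ} {Y : Set (ComplexTorus Φ)}
    {D : Fin k → Set (ComplexTorus Φ)} {τ : Fin k → ComplexTorus Φ}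
    (hZ : Y ∩ ⋂ j, (fun x ↦ x + τ j) ⁻¹' D j = ∅ ∨
      HasPureDim 𝓘(ℂ, E) (Y ∩ ⋂ j, (fun x ↦ x + τ j) ⁻¹' D j) (r + 1)) (C : Set (ComplexTorus Φ)) :
    IsIrreducibleComponent 𝓘(ℂ, E) (Y ∩ ⋂ j, (fun x ↦ x + τ j) ⁻¹' D j) C ↔
      IsIrreducibleComponent 𝓘(ℂ, E) (Y ∩ ⋂ j, (fun x ↦ x + τ j) ⁻¹' D j) C ∧ HasPureDim 𝓘(ℂ, E) C (r + 1) := by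
  refine ⟨fun hC ↦ ⟨hC, ?_⟩, fun h ↦ h.1⟩
  rcases hZ with hZ0 | hZr
  · exfalso
    obtain ⟨z, hz⟩ := hC.nonempty
    have := hC.subset hz
    rw [hZ0] at this
    exact this
  · exact hC.hasPureDim hZr

/-- **MULTIPLICITY ONE FROM EQUALITY IN BÉZOUT (proper intersections).** Let `η` be a Riemann form, `Y`
closed analytic of pure dimension `r + 1 + k`, `D₀, …, D_{k−1}` closed analytic hypersurfaces and `τ` with
`Z(τ) = Y ∩ ⋂_j (D_j − τ_j)` PROPER (empty or of pure dimension `r + 1`), its irreducible components listed by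
`S`. If `(L^{r+1} · Y · D₀ ⋯ D_{k−1}) ≤ #S` (hence `= #S`, file 9), then

  `sign(e)^k · [Y]_e ∧ [D₀]_e ∧ ⋯ ∧ [D_{k−1}]_e = [Z(τ)]_e`,

every component has `L`-degree `⟨c₁(L)^{∧(r+1)}, [C]⟩ = 1`, and the intersection number equals `#S`: in
Fulton's `Σ_j i(Z_j) deg Z_j = ∏ deg V_j` every `i(Z_j) = 1 = deg Z_j`. [cite: Fulton1998, §8.2 Prop. 8.2 (a), (c), §8.4 (1) and Example 8.4.6, §12.2 Cor. 12.2 (a)]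
[cite: deJong1993AmpleLineBundles, Ch. VII §4 Remarks 4.3 (a), (c) and Thm. 4.3.1] -/
theorem IsRiemannForm.smul_wedge_wedgeFamily_eq_setCycleClass_of_re_poincarePairing_le_card {q : ℕ}
    (hq : 2 * q + 2 * 1 = n) (k : ℕ) {d p p' r : ℕ} (hk : 2 * d + 2 * p = n) (hp' : p + k = p')
    (hr : r + 1 + k = d) {Y : Set (ComplexTorus Φ)} (hY : HasPureDim 𝓘(ℂ, E) Y d)
    {D : Fin k → Set (ComplexTorus Φ)} (hD : ∀ j, HasPureDim 𝓘(ℂ, E) (D j) q) (τ : Fin k → ComplexTorus Φ)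
    (hZ : Y ∩ ⋂ j, (fun x ↦ x + τ j) ⁻¹' D j = ∅ ∨
      HasPureDim 𝓘(ℂ, E) (Y ∩ ⋂ j, (fun x ↦ x + τ j) ⁻¹' D j) (r + 1))
    (S : Finset (Set (ComplexTorus Φ)))
    (hS : ∀ C, C ∈ S ↔ IsIrreducibleComponent 𝓘(ℂ, E) (Y ∩ ⋂ j, (fun x ↦ x + τ j) ⁻¹' D j) C)
    {η : E [⋀^Fin 2]→L[ℝ] ℝ} (hη : IsRiemannForm Φ η)
    (hle : (poincarePairing Φ e (by omega : 2 * (r + 1) + 2 * p' = n) (wedgePow (ofRealForm (-η)) (r + 1))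
        ((orientationSign Φ e : ℂ) ^ k •
          ((analyticCycleClass Φ e hk hY).wedge
              (wedgeFamily k fun j ↦ analyticCycleClass Φ e hq (hD j))).domDomCongr
            (finCongr (by omega : 2 * p + 2 * k = 2 * p')))).re ≤ S.card) :
    (orientationSign Φ e : ℂ) ^ k •
          ((analyticCycleClass Φ e hk hY).wedge
              (wedgeFamily k fun j ↦ analyticCycleClass Φ e hq (hD j))).domDomCongr
            (finCongr (by omega : 2 * p + 2 * k = 2 * p')) =
        setCycleClass Φ e (by omega : 2 * (r + 1) + 2 * p' = n) (Y ∩ ⋂ j, (fun x ↦ x + τ j) ⁻¹' D j) ∧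
      (∀ C ∈ S, poincarePairing Φ e (by omega : 2 * (r + 1) + 2 * p' = n) (wedgePow (ofRealForm (-η)) (r + 1))
        (setCycleClass Φ e (by omega : 2 * (r + 1) + 2 * p' = n) C) = 1) ∧
      poincarePairing Φ e (by omega : 2 * (r + 1) + 2 * p' = n) (wedgePow (ofRealForm (-η)) (r + 1))
        ((orientationSign Φ e : ℂ) ^ k •
          ((analyticCycleClass Φ e hk hY).wedge
              (wedgeFamily k fun j ↦ analyticCycleClass Φ e hq (hD j))).domDomCongr
            (finCongr (by omega : 2 * p + 2 * k = 2 * p'))) = S.card := by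
  have h2 : 2 * (r + 1) + 2 * p' = n := by omega
  have hS' : ∀ C, C ∈ S ↔ IsIrreducibleComponent 𝓘(ℂ, E) (Y ∩ ⋂ j, (fun x ↦ x + τ j) ⁻¹' D j) C ∧
      HasPureDim 𝓘(ℂ, E) C (r + 1) := fun C ↦
    (hS C).trans (isIrreducibleComponent_iff_and_hasPureDim_of_proper₂₀ Φ hZ C)
  obtain ⟨-, -, -, -, -, hdeg, -, -, hcl, hcard⟩ :=
    hη.exists_effectiveCycle_of_re_poincarePairing_le_card_properComponents Φ e hq k hk hp' hr hY hD τ S hS' hle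
  refine ⟨?_, hdeg, hcard⟩
  rw [hcl]
  rcases hZ with hZ0 | hZr
  · -- no components: both sides vanish
    have hS0 : S = ∅ := by
      refine Finset.eq_empty_of_forall_notMem fun C hC ↦ ?_
      obtain ⟨z, hz⟩ := ((hS C).1 hC).nonempty
      have := ((hS C).1 hC).subset hz
      rw [hZ0] at this
      exact this
    have hne : ¬ HasPureDim 𝓘(ℂ, E) (Y ∩ ⋂ j, (fun x ↦ x + τ j) ⁻¹' D j) (r + 1) := fun h ↦ by
      have := h.nonempty
      rw [hZ0] at this
      exact Set.not_nonempty_empty this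
    rw [hS0, Finset.sum_empty, setCycleClass, dif_neg hne]
  · rw [setCycleClass_of_hasPureDim Φ e h2 hZr, analyticCycleClass_eq_sum_setCycleClass_of_forall_iff Φ e h2 hZr S hS]

/-- **`Set.ncard` form: `(L^{r+1} · Y · D₀ ⋯ D_{k−1}) ≤ #{components of Z(τ)}` for a proper `Z(τ)` forces
`sign(e)^k · [Y] ∧ [D₀] ∧ ⋯ ∧ [D_{k−1}] = [Z(τ)]`** (with file 9 §2, `#components ≤ (L^{r+1} · Y · D₀ ⋯)`, this is
the equality case of Bézout). [cite: Fulton1998, §8.2 Prop. 8.2 (c), §8.4 (1) and Example 8.4.6]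
[cite: deJong1993AmpleLineBundles, Ch. VII §4 Thm. 4.3.1] -/
theorem IsRiemannForm.smul_wedge_wedgeFamily_eq_setCycleClass_of_re_poincarePairing_le_ncard {q : ℕ}
    (hq : 2 * q + 2 * 1 = n) (k : ℕ) {d p p' r : ℕ} (hk : 2 * d + 2 * p = n) (hp' : p + k = p')
    (hr : r + 1 + k = d) {Y : Set (ComplexTorus Φ)} (hY : HasPureDim 𝓘(ℂ, E) Y d)
    {D : Fin k → Set (ComplexTorus Φ)} (hD : ∀ j, HasPureDim 𝓘(ℂ, E) (D j) q) (τ : Fin k → ComplexTorus Φ)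
    (hZ : Y ∩ ⋂ j, (fun x ↦ x + τ j) ⁻¹' D j = ∅ ∨
      HasPureDim 𝓘(ℂ, E) (Y ∩ ⋂ j, (fun x ↦ x + τ j) ⁻¹' D j) (r + 1))
    {η : E [⋀^Fin 2]→L[ℝ] ℝ} (hη : IsRiemannForm Φ η)
    (hle : (poincarePairing Φ e (by omega : 2 * (r + 1) + 2 * p' = n) (wedgePow (ofRealForm (-η)) (r + 1))
        ((orientationSign Φ e : ℂ) ^ k •
          ((analyticCycleClass Φ e hk hY).wedge
              (wedgeFamily k fun j ↦ analyticCycleClass Φ e hq (hD j))).domDomCongr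
            (finCongr (by omega : 2 * p + 2 * k = 2 * p')))).re ≤
      {C : Set (ComplexTorus Φ) | IsIrreducibleComponent 𝓘(ℂ, E) (Y ∩ ⋂ j, (fun x ↦ x + τ j) ⁻¹' D j) C}.ncard) :
    (orientationSign Φ e : ℂ) ^ k •
          ((analyticCycleClass Φ e hk hY).wedge
              (wedgeFamily k fun j ↦ analyticCycleClass Φ e hq (hD j))).domDomCongr
            (finCongr (by omega : 2 * p + 2 * k = 2 * p')) =
        setCycleClass Φ e (by omega : 2 * (r + 1) + 2 * p' = n) (Y ∩ ⋂ j, (fun x ↦ x + τ j) ⁻¹' D j) ∧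
      poincarePairing Φ e (by omega : 2 * (r + 1) + 2 * p' = n) (wedgePow (ofRealForm (-η)) (r + 1))
        ((orientationSign Φ e : ℂ) ^ k •
          ((analyticCycleClass Φ e hk hY).wedge
              (wedgeFamily k fun j ↦ analyticCycleClass Φ e hq (hD j))).domDomCongr
            (finCongr (by omega : 2 * p + 2 * k = 2 * p'))) =
        ({C : Set (ComplexTorus Φ) |
          IsIrreducibleComponent 𝓘(ℂ, E) (Y ∩ ⋂ j, (fun x ↦ x + τ j) ⁻¹' D j) C}.ncard : ℕ) := by
  have hfin := finite_isIrreducibleComponent Φ (isAnalyticSet_inter_iInter_translate Φ hY hD τ)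
  rw [Set.ncard_eq_toFinset_card _ hfin] at hle ⊢
  obtain ⟨hcl, -, hcard⟩ := hη.smul_wedge_wedgeFamily_eq_setCycleClass_of_re_poincarePairing_le_card Φ e hq k
    hk hp' hr hY hD τ hZ hfin.toFinset (fun C ↦ hfin.mem_toFinset) hle
  exact ⟨hcl, hcard⟩

/-- **Amid excess components, `Set.ncard` form**: `(L^{r+1} · Y · D₀ ⋯ D_{k−1}) ≤ #{proper components of Z(τ)}`
forces `sign(e)^k · [Y] ∧ [D₀] ∧ ⋯ ∧ [D_{k−1}] = Σ_{C proper} [C]` and the intersection number `= #{proper components}`.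
[cite: Fulton1998, §8.4 (1) and Example 8.4.6, §12.2 Cor. 12.2 (a)] [cite: deJong1993AmpleLineBundles, Ch. VII §4 Thm. 4.3.1] -/
theorem IsRiemannForm.smul_wedge_wedgeFamily_eq_sum_setCycleClass_of_re_poincarePairing_le_ncard {q : ℕ}
    (hq : 2 * q + 2 * 1 = n) (k : ℕ) {d p p' r : ℕ} (hk : 2 * d + 2 * p = n) (hp' : p + k = p')
    (hr : r + 1 + k = d) {Y : Set (ComplexTorus Φ)} (hY : HasPureDim 𝓘(ℂ, E) Y d)
    {D : Fin k → Set (ComplexTorus Φ)} (hD : ∀ j, HasPureDim 𝓘(ℂ, E) (D j) q) (τ : Fin k → ComplexTorus Φ)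
    {η : E [⋀^Fin 2]→L[ℝ] ℝ} (hη : IsRiemannForm Φ η)
    (hle : (poincarePairing Φ e (by omega : 2 * (r + 1) + 2 * p' = n) (wedgePow (ofRealForm (-η)) (r + 1))
        ((orientationSign Φ e : ℂ) ^ k •
          ((analyticCycleClass Φ e hk hY).wedge
              (wedgeFamily k fun j ↦ analyticCycleClass Φ e hq (hD j))).domDomCongr
            (finCongr (by omega : 2 * p + 2 * k = 2 * p')))).re ≤
      {C : Set (ComplexTorus Φ) | IsIrreducibleComponent 𝓘(ℂ, E) (Y ∩ ⋂ j, (fun x ↦ x + τ j) ⁻¹' D j) C ∧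
        HasPureDim 𝓘(ℂ, E) C (r + 1)}.ncard) :
    (orientationSign Φ e : ℂ) ^ k •
          ((analyticCycleClass Φ e hk hY).wedge
              (wedgeFamily k fun j ↦ analyticCycleClass Φ e hq (hD j))).domDomCongr
            (finCongr (by omega : 2 * p + 2 * k = 2 * p')) =
        ∑ C ∈ (finite_setOf_isIrreducibleComponent_and_hasPureDim Φ (r := r + 1) hY hD τ).toFinset,
          setCycleClass Φ e (by omega : 2 * (r + 1) + 2 * p' = n) C ∧
      poincarePairing Φ e (by omega : 2 * (r + 1) + 2 * p' = n) (wedgePow (ofRealForm (-η)) (r + 1))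
        ((orientationSign Φ e : ℂ) ^ k •
          ((analyticCycleClass Φ e hk hY).wedge
              (wedgeFamily k fun j ↦ analyticCycleClass Φ e hq (hD j))).domDomCongr
            (finCongr (by omega : 2 * p + 2 * k = 2 * p'))) =
        ({C : Set (ComplexTorus Φ) |
          IsIrreducibleComponent 𝓘(ℂ, E) (Y ∩ ⋂ j, (fun x ↦ x + τ j) ⁻¹' D j) C ∧
            HasPureDim 𝓘(ℂ, E) C (r + 1)}.ncard : ℕ) := by
  have hfin := finite_setOf_isIrreducibleComponent_and_hasPureDim Φ (r := r + 1) hY hD τ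
  rw [Set.ncard_eq_toFinset_card _ hfin] at hle ⊢
  obtain ⟨-, -, -, -, -, -, -, -, hcl, hcard⟩ :=
    hη.exists_effectiveCycle_of_re_poincarePairing_le_card_properComponents Φ e hq k hk hp' hr hY hD τ
      hfin.toFinset (fun C ↦ hfin.mem_toFinset) hle
  exact ⟨hcl, hcard⟩

end ComplexTorus

end Literature.Geometry.Kaehler

end
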